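import Mathlib
import Summits.MatrixMultiplication.MatrixMultiplication.Theses.FourierTwoFamiliesModP

/-!
# Capacity gadgets `↔ PrimeTwoFamilies` — an explicit, elementary proof

Crux `stmt-MatrixMultiplication-14308` (`FourierTwoFamiliesModP.PrimeTwoFamilies`, CKSU 2005 Conj. 4.7 with
prime cyclic hosts), registered stub `capacityGadgets_iff_primeTwoFamilies` (siege, variation
"explicit / elementary").  This file is SELF-CONTAINED over Mathlib and the route file: no transfer,
bookkeeping or lifting lemma of the tree is used, and every constant is explicit.

* (⇐) Given the crux at slice `δ := min ε (1/2)`, take `m := p`, `r := n`, `L := 1`, `P := A`, `Q := B`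
  and `W :=` all words `Fin 1 → Fin n`; clause (X) of the SDPP is exactly the code condition, and
  `|A c| · |B c| ≤ p` (direct sums inside `ℤ/p`) makes `m = p` as large as required.
* (⇒) Given `δ > 0`, put `δ' := min δ 1`, `ε := δ'/8`, and ask for gadgets at a level
  `m ≥ max 2 (max n₀⁴ ⌈4^{8/δ'}⌉)`, so that `m^ε ≥ 4`.  The words of `W` lift to direct pairs
  `∏ₜ P (w t), ∏ₜ Q (w t)` in `(ℤ/m)^L` with the SDPP (`pi_direct`, `pi_cross`); the base-`2m` digit map
  followed by reduction modulo a Bertrand prime `p ∈ ((2m)^L, 2(2m)^L]` reflects two-fold sums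
  (`finFunctionFinEquiv` is injective), hence carries the SDPP into `ℤ/p` with the same sizes
  (`exists_prime_transfer`); keeping `n := ⌈(m^L)^{1/2-ε}⌉` words, `p ≤ 2^{L+1} m^L ≤ (m^L)^{1+ε} ≤ n^{2+δ}`
  and `n^{2-δ} ≤ 4 (m^L)^{1-2ε} ≤ (m^L)^{1-ε} ≤ |Aᵢ||Bᵢ|`.
-/

-- single-conjunct summit: the mandated namespace repeats `MatrixMultiplication` (summit = sub-problem).
set_option linter.dupNamespace false

namespace Summit.MatrixMultiplication.MatrixMultiplication.Theorems.PrimeTwoFamilies.ElementaryDigitLift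

open Finset
open Summit.MatrixMultiplication.MatrixMultiplication.Theses

section Lift

variable {K : Type*} [AddCommGroup K] {r L : ℕ}

/-- Product lift, clause (W): a word of direct pairs is a direct pair in `K^L` (coordinatewise). -/
theorem pi_direct (P Q : Fin r → Finset K)
    (hD : ∀ c : Fin r, ∀ x ∈ P c, ∀ x' ∈ P c, ∀ y ∈ Q c, ∀ y' ∈ Q c,
      (x - x') + (y - y') = 0 → x = x' ∧ y = y')
    (w : Fin L → Fin r) :
    ∀ a ∈ Fintype.piFinset (fun t => P (w t)), ∀ a' ∈ Fintype.piFinset (fun t => P (w t)),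
      ∀ b ∈ Fintype.piFinset (fun t => Q (w t)), ∀ b' ∈ Fintype.piFinset (fun t => Q (w t)),
      (a - a') + (b - b') = 0 → a = a' ∧ b = b' := by
  intro a ha a' ha' b hb b' hb' h
  rw [Fintype.mem_piFinset] at ha ha' hb hb'
  have key : ∀ t, a t = a' t ∧ b t = b' t := fun t =>
    hD (w t) _ (ha t) _ (ha' t) _ (hb t) _ (hb' t) (by simpa using congrFun h t)
  exact ⟨funext fun t => (key t).1, funext fun t => (key t).2⟩

/-- Product lift, clause (X): for an injective family of words, pairwise strongly separated in some
coordinate (a zero-error code), the lifted pairs have the cross condition of the SDPP. -/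
theorem pi_cross (P Q : Fin r → Finset K) {n : ℕ} (w : Fin n → Fin L → Fin r)
    (hw : Function.Injective w)
    (hCode : ∀ i k : Fin n, w i ≠ w k → ∃ t : Fin L,
      ∀ p ∈ P (w i t), ∀ q ∈ Q (w k t), ∀ c : Fin r, ∀ p' ∈ P c, ∀ q' ∈ Q c, q - p ≠ q' - p') :
    ∀ i j k : Fin n, ∀ a ∈ Fintype.piFinset (fun t => P (w i t)),
      ∀ a' ∈ Fintype.piFinset (fun t => P (w j t)), ∀ b ∈ Fintype.piFinset (fun t => Q (w j t)),
      ∀ b' ∈ Fintype.piFinset (fun t => Q (w k t)), (a - a') + (b - b') = 0 → i = k := by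
  intro i j k a ha a' ha' b hb b' hb' h
  by_contra hik
  rw [Fintype.mem_piFinset] at ha ha' hb hb'
  obtain ⟨t, ht⟩ := hCode i k fun h' => hik (hw h')
  have h0 : a t - a' t + (b t - b' t) = 0 := by simpa using congrFun h t
  refine ht _ (ha t) _ (hb' t) (w j t) _ (ha' t) _ (hb t) ?_
  have h1 : b' t - a t - (b t - a' t) = -(a t - a' t + (b t - b' t)) := by abel
  rw [h0, neg_zero, sub_eq_zero] at h1
  exact h1

end Lift

section Transfer

/-- Base-`R` expansions with digits `< R` are unique (`finFunctionFinEquiv` is injective). -/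
theorem digits_injective {R L : ℕ} (d d' : Fin L → Fin R)
    (h : ∑ t, (d t : ℕ) * R ^ (t : ℕ) = ∑ t, (d' t : ℕ) * R ^ (t : ℕ)) : d = d' :=
  finFunctionFinEquiv.injective
    (Fin.ext (by rw [finFunctionFinEquiv_apply, finFunctionFinEquiv_apply, h]))

/-- A base-`R` expansion of length `L` with digits `< R` is `< R^L`. -/
theorem digits_lt {R L : ℕ} (d : Fin L → Fin R) : ∑ t, (d t : ℕ) * R ^ (t : ℕ) < R ^ L := by
  rw [← finFunctionFinEquiv_apply]
  exact (finFunctionFinEquiv d).isLt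

/-- The base-`2m` digit map reflects two-fold sums: if the digit vectors of `a + b` and `a' + b'`
(digits `val (a t) + val (b t) < 2m`, no carries) have the same value, then `a + b = a' + b'`. -/
theorem digit_reflect {m L : ℕ} [NeZero m] (a b a' b' : Fin L → ZMod m)
    (h : ∑ t, ((a t).val + (b t).val) * (2 * m) ^ (t : ℕ) =
      ∑ t, ((a' t).val + (b' t).val) * (2 * m) ^ (t : ℕ)) :
    a + b = a' + b' := by
  have hlt : ∀ x y : ZMod m, x.val + y.val < 2 * m := fun x y => by
    have := x.val_lt; have := y.val_lt; omega
  have key := digits_injective (R := 2 * m) (fun t => ⟨(a t).val + (b t).val, hlt _ _⟩)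
    (fun t => ⟨(a' t).val + (b' t).val, hlt _ _⟩) h
  funext t
  have ht : (a t).val + (b t).val = (a' t).val + (b' t).val := by
    have := congrFun key t
    simpa using this
  have ht' := congrArg (Nat.cast : ℕ → ZMod m) ht
  simpa [ZMod.natCast_val] using ht'

/-- **Explicit carry-free lift into a prime cyclic group.**  SDPP pairs in `(ℤ/m)^L` (`m ≥ 1`) have
images of the same sizes forming SDPP pairs in `ℤ/p` for a prime `p ≤ 2 · (2m)^L`: the base-`2m` digit map
reduced modulo a Bertrand prime `p ∈ ((2m)^L, 2 (2m)^L]` reflects two-fold sums (values `< (2m)^L < p`). -/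
theorem exists_prime_transfer {m L n : ℕ} [NeZero m] {A B : Fin n → Finset (Fin L → ZMod m)}
    (hW : ∀ i : Fin n, ∀ a ∈ A i, ∀ a' ∈ A i, ∀ b ∈ B i, ∀ b' ∈ B i,
      (a - a') + (b - b') = 0 → a = a' ∧ b = b')
    (hX : ∀ i j k : Fin n, ∀ a ∈ A i, ∀ a' ∈ A j, ∀ b ∈ B j, ∀ b' ∈ B k,
      (a - a') + (b - b') = 0 → i = k) :
    ∃ p : ℕ, p.Prime ∧ p ≤ 2 * (2 * m) ^ L ∧ ∃ A' B' : Fin n → Finset (ZMod p),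
      (∀ i, (A' i).card = (A i).card ∧ (B' i).card = (B i).card) ∧
      (∀ i : Fin n, ∀ a ∈ A' i, ∀ a' ∈ A' i, ∀ b ∈ B' i, ∀ b' ∈ B' i,
        (a - a') + (b - b') = 0 → a = a' ∧ b = b') ∧
      (∀ i j k : Fin n, ∀ a ∈ A' i, ∀ a' ∈ A' j, ∀ b ∈ B' j, ∀ b' ∈ B' k,
        (a - a') + (b - b') = 0 → i = k) := by
  classical
  have hR : (2 * m) ^ L ≠ 0 := pow_ne_zero _ (by have := NeZero.ne m; omega)
  obtain ⟨p, hp, hRp, hp2⟩ := Nat.exists_prime_lt_and_le_two_mul _ hR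
  -- the digit map and its additivity on digit vectors
  set N : (Fin L → ZMod m) → ℕ := fun x => ∑ t, (x t).val * (2 * m) ^ (t : ℕ) with hN
  have hNadd : ∀ a b : Fin L → ZMod m,
      N a + N b = ∑ t, ((a t).val + (b t).val) * (2 * m) ^ (t : ℕ) := by
    intro a b
    simp only [hN, ← Finset.sum_add_distrib, add_mul]
  have hlt2 : ∀ x y : ZMod m, x.val + y.val < 2 * m := fun x y => by
    have := x.val_lt; have := y.val_lt; omega
  have hNlt : ∀ a b : Fin L → ZMod m, N a + N b < p := by
    intro a b
    rw [hNadd]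
    exact (digits_lt (fun t => (⟨(a t).val + (b t).val, hlt2 _ _⟩ : Fin (2 * m)))).trans hRp
  set φ : (Fin L → ZMod m) → ZMod p := fun x => ((N x : ℕ) : ZMod p) with hφ
  have hrefl : ∀ a b a' b', φ a + φ b = φ a' + φ b' → a + b = a' + b' := by
    intro a b a' b' h
    have h' : ((N a + N b : ℕ) : ZMod p) = ((N a' + N b' : ℕ) : ZMod p) := by
      push_cast; exact h
    rw [ZMod.natCast_eq_natCast_iff', Nat.mod_eq_of_lt (hNlt _ _), Nat.mod_eq_of_lt (hNlt _ _),
      hNadd, hNadd] at h'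
    exact digit_reflect a b a' b' h'
  have hinj : Function.Injective φ := fun a a' h =>
    add_right_cancel (hrefl a a a' a (by rw [h]))
  refine ⟨p, hp, hp2, fun i => (A i).image φ, fun i => (B i).image φ,
    fun i => ⟨card_image_of_injective _ hinj, card_image_of_injective _ hinj⟩, ?_, ?_⟩
  · intro i x hx x' hx' y hy y' hy' he
    obtain ⟨a, ha, rfl⟩ := mem_image.1 hx
    obtain ⟨a', ha', rfl⟩ := mem_image.1 hx'
    obtain ⟨b, hb, rfl⟩ := mem_image.1 hy
    obtain ⟨b', hb', rfl⟩ := mem_image.1 hy'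
    have h3 := hrefl a b a' b' (by rw [← sub_eq_zero, ← he]; abel)
    obtain ⟨rfl, rfl⟩ := hW i a ha a' ha' b hb b' hb'
      (by rw [← sub_eq_zero] at h3; rw [← h3]; abel)
    exact ⟨rfl, rfl⟩
  · intro i j k x hx x' hx' y hy y' hy' he
    obtain ⟨a, ha, rfl⟩ := mem_image.1 hx
    obtain ⟨a', ha', rfl⟩ := mem_image.1 hx'
    obtain ⟨b, hb, rfl⟩ := mem_image.1 hy
    obtain ⟨b', hb', rfl⟩ := mem_image.1 hy'
    have h3 := hrefl a b a' b' (by rw [← sub_eq_zero, ← he]; abel)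
    exact hX i j k a ha a' ha' b hb b' hb' (by rw [← sub_eq_zero] at h3; rw [← h3]; abel)

end Transfer

/-- **Capacity gadgets ↔ `PrimeTwoFamilies`** (registered stub of crux stmt-MatrixMultiplication-14308,
explicit / elementary proof).  (⇒) lift the code words to direct pairs in `(ℤ/m)^L` (`pi_direct`,
`pi_cross`), move them into `ℤ/p` by the base-`2m` digit map (`exists_prime_transfer`), keep
`n = ⌈(m^L)^{1/2-ε}⌉` of them, with `ε = min δ 1 / 8` and `m ≥ max 2 (max n₀⁴ ⌈4^{8/min δ 1}⌉)`;
(⇐) the crux at slice `min ε (1/2)` with `L = 1` and all one-letter words. -/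
theorem capacityGadgets_iff_primeTwoFamilies :
    (∀ ε : ℝ, 0 < ε → ∀ m₀ : ℕ, ∃ m ≥ m₀, ∃ r L : ℕ, ∃ P Q : Fin r → Finset (ZMod m),
      ∃ W : Finset (Fin L → Fin r),
      (∀ c : Fin r, ∀ x ∈ P c, ∀ x' ∈ P c, ∀ y ∈ Q c, ∀ y' ∈ Q c,
          (x - x') + (y - y') = 0 → x = x' ∧ y = y') ∧
      (∀ i ∈ W, ∀ k ∈ W, i ≠ k → ∃ t : Fin L,
        ∀ p ∈ P (i t), ∀ q ∈ Q (k t), ∀ c : Fin r, ∀ p' ∈ P c, ∀ q' ∈ Q c, q - p ≠ q' - p') ∧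
      1 ≤ L ∧
      ((m : ℝ) ^ (L : ℝ)) ^ (1 / 2 - ε) ≤ (W.card : ℝ) ∧
      ∀ c : Fin r, (m : ℝ) ^ (1 - ε) ≤ (((P c).card * (Q c).card : ℕ) : ℝ)) ↔
    FourierTwoFamiliesModP.PrimeTwoFamilies := by
  classical
  refine ⟨fun hC => ?_, fun hT => ?_⟩
  · -- (⇒) gadgets give the crux
    intro δ hδ n₀
    -- constants
    set δ' : ℝ := min δ 1 with hδ'def
    have hδ' : 0 < δ' := lt_min hδ one_pos
    have hδ'δ : δ' ≤ δ := min_le_left _ _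
    have hδ'1 : δ' ≤ 1 := min_le_right _ _
    set ε : ℝ := δ' / 8 with hεdef
    have hε : 0 < ε := by positivity
    have hε8 : ε ≤ 1 / 8 := by rw [hεdef]; linarith
    set T : ℝ := (4 : ℝ) ^ (8 / δ') with hTdef
    obtain ⟨m, hm, r, L, P, Q, W, hD, hCode, hL, hWcard, hcov⟩ :=
      hC ε hε (max 2 (max (n₀ ^ 4) ⌈T⌉₊))
    have hm2 : 2 ≤ m := le_trans (le_max_left _ _) hm
    have hmn₀ : n₀ ^ 4 ≤ m := le_trans ((le_max_left _ _).trans (le_max_right _ _)) hm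
    have hmT : T ≤ m := (Nat.le_ceil T).trans
      (by exact_mod_cast le_trans ((le_max_right _ _).trans (le_max_right _ _)) hm)
    haveI : NeZero m := ⟨by omega⟩
    have hm1 : (1 : ℝ) ≤ m := by exact_mod_cast (by omega : 1 ≤ m)
    have hm0 : (0 : ℝ) < m := by positivity
    -- the level is large: `4 ≤ m ^ ε`
    have h4 : (4 : ℝ) ≤ (m : ℝ) ^ ε := by
      have h1 : T ^ ε = 4 := by
        rw [hTdef, ← Real.rpow_mul (by norm_num)]
        have : 8 / δ' * ε = 1 := by rw [hεdef]; field_simp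
        rw [this, Real.rpow_one]
      rw [← h1]
      exact Real.rpow_le_rpow (by positivity) hmT hε.le
    -- `M := m^L`, `X := M^(1/2-ε)`, `n := ⌈X⌉`
    set M : ℝ := (m : ℝ) ^ (L : ℝ) with hMdef
    have hM1 : 1 ≤ M := Real.one_le_rpow hm1 (Nat.cast_nonneg _)
    have hM0 : 0 < M := by positivity
    have hMm : (m : ℝ) ≤ M := by
      have : (m : ℝ) ^ (1 : ℝ) ≤ (m : ℝ) ^ (L : ℝ) :=
        Real.rpow_le_rpow_of_exponent_le hm1 (by exact_mod_cast hL)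
      rwa [Real.rpow_one] at this
    have hML : (m : ℝ) ^ L = M := by rw [hMdef, Real.rpow_natCast]
    set X : ℝ := M ^ (1 / 2 - ε) with hXdef
    have hX1 : 1 ≤ X := Real.one_le_rpow hM1 (by linarith)
    have hX0 : 0 < X := by positivity
    set n : ℕ := ⌈X⌉₊ with hndef
    have hnX : X ≤ n := Nat.le_ceil X
    have hn2X : (n : ℝ) ≤ 2 * X := by
      have := Nat.ceil_lt_add_one hX0.le
      linarith
    have hn1 : (1 : ℝ) ≤ n := hX1.trans hnX
    have hn0 : (0 : ℝ) < n := by linarith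
    have hnW : n ≤ W.card := by rw [hndef, Nat.ceil_le]; exact hWcard
    obtain ⟨W', hW'W, hW'card⟩ := Finset.exists_subset_card_eq hnW
    -- enumerate `W'` by `Fin n`
    let e : Fin n ≃ W' := (W'.equivFin.trans (finCongr hW'card)).symm
    let w : Fin n → Fin L → Fin r := fun i => (e i).1
    have hw : Function.Injective w := fun i k h => e.injective (Subtype.ext h)
    have hwW : ∀ i, w i ∈ W := fun i => hW'W (e i).2
    -- the lifted family in `(ℤ/m)^L`
    set A₀ : Fin n → Finset (Fin L → ZMod m) := fun i => Fintype.piFinset fun t => P (w i t) with hA₀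
    set B₀ : Fin n → Finset (Fin L → ZMod m) := fun i => Fintype.piFinset fun t => Q (w i t) with hB₀
    have hW₀ : ∀ i : Fin n, ∀ a ∈ A₀ i, ∀ a' ∈ A₀ i, ∀ b ∈ B₀ i, ∀ b' ∈ B₀ i,
        (a - a') + (b - b') = 0 → a = a' ∧ b = b' :=
      fun i => pi_direct P Q hD (w i)
    have hX₀ : ∀ i j k : Fin n, ∀ a ∈ A₀ i, ∀ a' ∈ A₀ j, ∀ b ∈ B₀ j, ∀ b' ∈ B₀ k,
        (a - a') + (b - b') = 0 → i = k :=
      pi_cross P Q w hw fun i k hik => hCode _ (hwW i) _ (hwW k) hik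
    -- transfer into a prime cyclic host
    obtain ⟨p, hp, hp2, A, B, hcard, hWA, hXA⟩ := exists_prime_transfer hW₀ hX₀
    refine ⟨n, ?_, p, hp, A, B, hWA, hXA, ?_, ?_⟩
    · -- `n₀ ≤ n`: `n₀ = (n₀⁴)^{1/4} ≤ m^{1/4} ≤ M^{1/4} ≤ M^{1/2-ε} = X ≤ n`
      have hmn₀' : ((n₀ : ℝ) ^ 4) ≤ m := by exact_mod_cast hmn₀
      have h1 : ((n₀ : ℝ) ^ 4) ^ ((4 : ℕ) : ℝ)⁻¹ = n₀ :=
        Real.pow_rpow_inv_natCast (Nat.cast_nonneg _) (by norm_num)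
      have h2 : ((n₀ : ℝ) ^ 4) ^ ((4 : ℕ) : ℝ)⁻¹ ≤ (m : ℝ) ^ ((4 : ℕ) : ℝ)⁻¹ :=
        Real.rpow_le_rpow (by positivity) hmn₀' (by positivity)
      have h3 : (m : ℝ) ^ ((4 : ℕ) : ℝ)⁻¹ ≤ M ^ ((4 : ℕ) : ℝ)⁻¹ :=
        Real.rpow_le_rpow hm0.le hMm (by positivity)
      have h5 : M ^ ((4 : ℕ) : ℝ)⁻¹ ≤ X :=
        Real.rpow_le_rpow_of_exponent_le hM1 (by norm_num; linarith)
      have : (n₀ : ℝ) ≤ n := by rw [← h1]; linarith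
      exact_mod_cast this
    · -- `p ≤ 2 (2m)^L ≤ 4^L m^L ≤ M^ε · M = M^{1+ε} ≤ X^{2+δ'} ≤ n^{2+δ'} ≤ n^{2+δ}`
      have hpR : (p : ℝ) ≤ 2 * (2 * m) ^ L := by exact_mod_cast hp2
      have hL1 : (2 : ℝ) ≤ 2 ^ L := by
        calc (2 : ℝ) = 2 ^ 1 := by norm_num
          _ ≤ 2 ^ L := pow_le_pow_right₀ (by norm_num) hL
      have step1 : (2 : ℝ) * (2 * m) ^ L ≤ 4 ^ L * (m : ℝ) ^ L := by
        have : (4 : ℝ) ^ L * (m : ℝ) ^ L = 2 ^ L * (2 * m) ^ L := by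
          rw [← mul_pow, ← mul_pow]; ring
        rw [this]
        exact mul_le_mul_of_nonneg_right hL1 (by positivity)
      have step2 : (4 : ℝ) ^ L ≤ M ^ ε := by
        have : M ^ ε = ((m : ℝ) ^ ε) ^ L := by
          rw [hMdef, ← Real.rpow_natCast, ← Real.rpow_mul hm0.le, ← Real.rpow_mul hm0.le, mul_comm]
        rw [this]
        exact pow_le_pow_left₀ (by norm_num) h4 L
      have step3 : (p : ℝ) ≤ M ^ (ε + 1) := by
        rw [Real.rpow_add hM0, Real.rpow_one]
        calc (p : ℝ) ≤ 2 * (2 * m) ^ L := hpR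
          _ ≤ 4 ^ L * (m : ℝ) ^ L := step1
          _ ≤ M ^ ε * M := by rw [hML]; exact mul_le_mul_of_nonneg_right step2 hM0.le
      have hexp : ε + 1 ≤ (1 / 2 - ε) * (2 + δ') := by
        rw [hεdef]; nlinarith [hδ', hδ'1]
      have step4 : M ^ (ε + 1) ≤ X ^ (2 + δ') := by
        rw [hXdef, ← Real.rpow_mul hM0.le]
        exact Real.rpow_le_rpow_of_exponent_le hM1 hexp
      have step5 : X ^ (2 + δ') ≤ (n : ℝ) ^ (2 + δ') :=
        Real.rpow_le_rpow hX0.le hnX (by linarith)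
      have step6 : (n : ℝ) ^ (2 + δ') ≤ (n : ℝ) ^ (2 + δ) :=
        Real.rpow_le_rpow_of_exponent_le hn1 (by linarith)
      linarith
    · -- `n^{2-δ} ≤ n² ≤ 4 X² = 4 M^{1-2ε} ≤ M^ε M^{1-2ε} = M^{1-ε} = ∏ₜ m^{1-ε} ≤ |Aᵢ| |Bᵢ|`
      intro i
      rw [(hcard i).1, (hcard i).2]
      simp only [hA₀, hB₀, Fintype.card_piFinset]
      push_cast
      rw [← Finset.prod_mul_distrib]
      have hprod : M ^ (1 - ε) ≤ ∏ t : Fin L, (((P (w i t)).card : ℝ) * ((Q (w i t)).card : ℝ)) := by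
        have : M ^ (1 - ε) = ∏ _t : Fin L, (m : ℝ) ^ (1 - ε) := by
          rw [Finset.prod_const, Finset.card_univ, Fintype.card_fin, hMdef, ← Real.rpow_natCast,
            ← Real.rpow_mul hm0.le, ← Real.rpow_mul hm0.le, mul_comm]
        rw [this]
        refine Finset.prod_le_prod (fun t _ => by positivity) fun t _ => ?_
        have := hcov (w i t)
        push_cast at this
        exact this
      have s1 : (n : ℝ) ^ (2 - δ) ≤ (n : ℝ) ^ (2 : ℝ) :=
        Real.rpow_le_rpow_of_exponent_le hn1 (by linarith)
      have s2 : (n : ℝ) ^ (2 : ℝ) ≤ 4 * X ^ (2 : ℝ) := by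
        rw [Real.rpow_two, Real.rpow_two]; nlinarith [hn2X, hn0, hX0]
      have s3 : X ^ (2 : ℝ) = M ^ (1 - 2 * ε) := by
        rw [hXdef, ← Real.rpow_mul hM0.le]; congr 1; ring
      have s4 : (4 : ℝ) * M ^ (1 - 2 * ε) ≤ M ^ ε * M ^ (1 - 2 * ε) :=
        mul_le_mul_of_nonneg_right (h4.trans (Real.rpow_le_rpow hm0.le hMm hε.le)) (by positivity)
      have s5 : M ^ ε * M ^ (1 - 2 * ε) = M ^ (1 - ε) := by
        rw [← Real.rpow_add hM0]; congr 1; ring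
      calc (n : ℝ) ^ (2 - δ) ≤ (n : ℝ) ^ (2 : ℝ) := s1
        _ ≤ 4 * X ^ (2 : ℝ) := s2
        _ = 4 * M ^ (1 - 2 * ε) := by rw [s3]
        _ ≤ M ^ ε * M ^ (1 - 2 * ε) := s4
        _ = M ^ (1 - ε) := s5
        _ ≤ _ := hprod
  · -- (⇐) the crux gives gadgets with `L = 1`
    intro ε hε m₀
    set δ : ℝ := min ε (1 / 2) with hδdef
    have hδ : 0 < δ := lt_min hε (by norm_num)
    have hδε : δ ≤ ε := min_le_left _ _
    have hδ1 : δ ≤ 1 / 2 := min_le_right _ _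
    obtain ⟨n, hn, p, hp, A, B, hW, hX, hpn, hAB⟩ := hT δ hδ (max m₀ 2)
    have hn2 : 2 ≤ n := le_trans (le_max_right _ _) hn
    have hnm₀ : m₀ ≤ n := le_trans (le_max_left _ _) hn
    have hn1 : (1 : ℝ) ≤ n := by exact_mod_cast (by omega : 1 ≤ n)
    have hn0 : (0 : ℝ) < n := by linarith
    have hp1 : (1 : ℝ) ≤ p := by exact_mod_cast hp.one_lt.le
    have hp0 : (0 : ℝ) < p := by linarith
    haveI : Fact p.Prime := ⟨hp⟩
    -- direct sums inside `ℤ/p`: `|A c| · |B c| ≤ p`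
    have hcov_le : ∀ c : Fin n, (A c).card * (B c).card ≤ p := by
      intro c
      have h := Finset.card_le_card_of_injOn (s := A c ×ˢ B c) (t := (Finset.univ : Finset (ZMod p)))
        (fun x => x.1 + x.2) (fun _ _ => Finset.mem_coe.2 (Finset.mem_univ _)) ?_
      · rwa [Finset.card_product, Finset.card_univ, ZMod.card] at h
      intro x hx y hy hxy
      obtain ⟨hx1, hx2⟩ := Finset.mem_product.1 (Finset.mem_coe.1 hx)
      obtain ⟨hy1, hy2⟩ := Finset.mem_product.1 (Finset.mem_coe.1 hy)
      have hxy' : x.1 + x.2 = y.1 + y.2 := hxy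
      obtain ⟨h1, h2⟩ := hW c x.1 hx1 y.1 hy1 x.2 hx2 y.2 hy2
        (by rw [← sub_eq_zero] at hxy'; rw [← hxy']; abel)
      exact Prod.ext h1 h2
    -- covolumes are `≥ 1` and `m = p ≥ n ≥ m₀`
    have hcov1 : ∀ c : Fin n, (1 : ℝ) ≤ (((A c).card * (B c).card : ℕ) : ℝ) := fun c =>
      (Real.one_le_rpow hn1 (by linarith)).trans (hAB c)
    have hpm₀ : m₀ ≤ p := by
      have c : Fin n := ⟨0, by omega⟩
      have h1 : (n : ℝ) ≤ (n : ℝ) ^ (2 - δ) := by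
        have := Real.rpow_le_rpow_of_exponent_le hn1 (show (1 : ℝ) ≤ 2 - δ by linarith)
        rwa [Real.rpow_one] at this
      have h2 : (((A c).card * (B c).card : ℕ) : ℝ) ≤ p := by exact_mod_cast hcov_le c
      have : (m₀ : ℝ) ≤ p := by
        have : (m₀ : ℝ) ≤ n := by exact_mod_cast hnm₀
        linarith [hAB c]
      exact_mod_cast this
    refine ⟨p, hpm₀, n, 1, A, B, Finset.univ, hW, ?_, le_rfl, ?_, ?_⟩
    · -- the code condition is clause (X)
      intro i _ k _ hik
      refine ⟨0, fun x hx y hy c x' hx' y' hy' hq => hik ?_⟩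
      have h0 := hX (i 0) c (k 0) x hx x' hx' y' hy' y hy
        (by have : (x - x') + (y' - y) = (y' - x') - (y - x) := by abel
            rw [this, hq, sub_self])
      funext t
      rw [Subsingleton.elim t 0]
      exact h0
    · -- `(p^1)^{1/2-ε} ≤ n = |W|`
      have hWc : ((Finset.univ : Finset (Fin 1 → Fin n)).card : ℝ) = n := by
        rw [Finset.card_univ, Fintype.card_fun, Fintype.card_fin, Fintype.card_fin, pow_one]
      rw [hWc, Nat.cast_one, Real.rpow_one]
      by_cases h : 1 / 2 - ε ≤ 0
      · exact (Real.rpow_le_one_of_one_le_of_nonpos hp1 h).trans hn1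
      · push Not at h
        calc (p : ℝ) ^ (1 / 2 - ε) ≤ ((n : ℝ) ^ (2 + δ)) ^ (1 / 2 - ε) :=
              Real.rpow_le_rpow hp0.le hpn h.le
          _ = (n : ℝ) ^ ((2 + δ) * (1 / 2 - ε)) := by rw [← Real.rpow_mul hn0.le]
          _ ≤ (n : ℝ) ^ (1 : ℝ) :=
              Real.rpow_le_rpow_of_exponent_le hn1 (by nlinarith [mul_pos hδ hε])
          _ = n := Real.rpow_one _
    · -- `p^{1-ε} ≤ n^{2-δ} ≤ |A c| |B c|`
      intro c
      by_cases h : 1 - ε ≤ 0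
      · exact (Real.rpow_le_one_of_one_le_of_nonpos hp1 h).trans (hcov1 c)
      · push Not at h
        calc (p : ℝ) ^ (1 - ε) ≤ ((n : ℝ) ^ (2 + δ)) ^ (1 - ε) :=
              Real.rpow_le_rpow hp0.le hpn h.le
          _ = (n : ℝ) ^ ((2 + δ) * (1 - ε)) := by rw [← Real.rpow_mul hn0.le]
          _ ≤ (n : ℝ) ^ (2 - δ) :=
              Real.rpow_le_rpow_of_exponent_le hn1 (by nlinarith [mul_pos hδ hε])
          _ ≤ _ := hAB c

end Summit.MatrixMultiplication.MatrixMultiplication.Theorems.PrimeTwoFamilies.ElementaryDigitLift
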